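import Literature.Computability.Cryptography.QuantumTuringMachinePositionedFaithful
import Literature.Computability.Cryptography.QuantumTuringMachinePositionedOblivious
import Literature.Computability.Cryptography.QuantumTuringMachineWellFormed
import HarnessLib

/-!
# Quantum Turing machines from a local rule: a bijection of (state, symbol) pairs preceded by a unitary

Toolkit file for CONSTRUCTING well-formed quantum Turing machines (Bernstein–Vazirani 1997, §4
"Programming a QTM": all machines built there and in Nishimura–Ozawa 2002, Lemma 5.1, are
unidirectional — Def. 3.14, each state is entered from one direction only — and their local
transition function is, ignoring the forced direction, a unitary map from superpositions of
(current state, scanned symbol) to superpositions of (new state, written symbol), BV remark after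
Thm. 5.3, p. 1434; for the reversible deterministic components it is a permutation,
BV App. B, Cor. B.2). This file packages that shape once and for all:

* `QTM.ofRule q₀ qa emb dir amp perm` — the machine with control states `Λ`, tape
  alphabet `Γ`, direction assignment `dir : Λ → Dir` (the direction with which a state is
  entered), a "pre-unitary" `amp : Λ × Γ → Λ × Γ → ℂ` and a bijection
  `perm : Λ × Γ ≃ Λ × Γ`; its transition amplitudes are
  `δ p a q b d = [d = dir q] · amp (p, a) (perm⁻¹ (q, b))`, i.e. the column of `(p, a)` is
  `∑_z amp (p, a) z • |perm z⟩`: first the unitary `amp` acts on the pair (state, symbol) — in the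
  applications only on qubits parked in the finite control — then the classical reversible rule
  `perm` rewrites state and symbol, and the head moves in the direction `dir` of the new state;
* `QTM.ofRule_isWellFormed`, `QTM.ofRule_pIsWellFormed` — if the rows of `amp` are orthonormal
  (`amp` is unitary) the machine is well formed, in the tree's model (via
  `QTM.isWellFormed_of_unidirectional`, BV Thm. 5.3) and in Bernstein–Vazirani's positioned model
  (`QTM.IsWellFormed.pIsWellFormed`, alphabets with a non-blank symbol);
* `QTM.ofRule_amplitudes_subset` — its amplitudes are values of `amp` or `0` (bookkeeping for the
  classes `BQPQTMWith S` / `BQPQTMPosWith S`);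
* `QTM.ofRule_pevolve_single` — one positioned step from a basis state,
  `U |(p, T), ξ⟩ = ∑_z amp (p, T₀) z • |tgt (perm z)⟩`; the classical case
  `QTM.ofRule_pevolve_single_of_classical` (the column of `(p, T₀)` under `amp` is the basis vector
  of `(p, T₀)` itself: the step is deterministic, `|c⟩ ↦ |tgt (perm (p, T₀))⟩`), with the target
  described by absolute cell contents (`QTM.PCfg.cells`, `…PositionedFaithful.lean`):
  the head cell is overwritten and the position moves by `∓1` (`QTM.cells_detTarget`,
  `QTM.snd_detTarget`).

Everything is proved; no named fact is introduced. Consumers: the oblivious sweep machines of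
`QuantumTuringMachineSweep.lean` (synchronous constructions à la BV Thm. 4.3 / NO Lemma 5.1).

## References

* E. Bernstein, U. Vazirani, *Quantum complexity theory*, SIAM J. Comput. 26 (1997) 1411–1473
  [BernsteinVaziraniSICOMP1997]: Def. 3.2 (time evolution), Def. 3.14 (unidirectional),
  Thm. 5.3 and the remark following it (p. 1434), App. B, Cor. B.2 (reversible TMs), §4.
* H. Nishimura, M. Ozawa, *Computational complexity of uniform quantum circuit families and
  quantum Turing machines*, Theoret. Comput. Sci. 276 (2002) 147–181 [NishimuraOzawa2002]:
  §2 (unidirectional QTMs, `|q,T,ξ⟩ ↦ |p,T_ξ^τ,ξ+d⟩`), Lemma 5.1.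
-/

noncomputable section

namespace Literature.Computability.Cryptography

namespace QTM

open Turing Finsupp
open scoped BigOperators ComplexConjugate

/-! ### The constructor -/

section Constructor

variable {Λ Γ : Type} [Fintype Λ] [DecidableEq Λ] [Fintype Γ] [DecidableEq Γ] [Inhabited Γ]

/-- **The machine of a local rule.** Control states `Λ`, tape alphabet `Γ` (blank = `default`),
start/accept states, input embedding, a direction assignment `dir` (the direction with which each
state is entered — the machine is unidirectional, Bernstein–Vazirani 1997, Def. 3.14), a
pre-unitary `amp` on (state, symbol) pairs and a bijection `perm` of (state, symbol) pairs. The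
amplitude of "in state `p` reading `a`: write `b`, enter `q`, move `d`" is
`[d = dir q] · amp (p, a) (perm⁻¹ (q, b))` (BV 1997, remark after Thm. 5.3: a unidirectional
machine is well formed iff this (state, symbol) ↦ (state, symbol) matrix is unitary). [cite: BernsteinVaziraniSICOMP1997, Def. 3.14 and Thm. 5.3 (remark, p. 1434)] -/
@[reducible] def ofRule (q₀ qa : Λ) (emb : Bool → Γ) (dir : Λ → Dir) (amp : Λ × Γ → Λ × Γ → ℂ)
    (perm : Λ × Γ ≃ Λ × Γ) : QTM where
  Λ := Λ
  Γ := Γ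
  start := q₀
  accept := qa
  embed := emb
  δ := fun p a q b d => if d = dir q then amp (p, a) (perm.symm (q, b)) else 0

variable (q₀ qa : Λ) (emb : Bool → Γ) (dir : Λ → Dir) (amp : Λ × Γ → Λ × Γ → ℂ)
  (perm : Λ × Γ ≃ Λ × Γ)

/-- The transition amplitudes of `ofRule` in the entering direction. [cite: BernsteinVaziraniSICOMP1997, Def. 3.14] -/
@[simp] theorem ofRule_δ_dir (p : Λ) (a : Γ) (q : Λ) (b : Γ) :
    (ofRule q₀ qa emb dir amp perm).δ p a q b (dir q) = amp (p, a) (perm.symm (q, b)) := by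
  simp

/-- `ofRule` is unidirectional: amplitudes into `q` against the direction `dir q` vanish
(Bernstein–Vazirani 1997, Def. 3.14). [cite: BernsteinVaziraniSICOMP1997, Def. 3.14] -/
theorem ofRule_δ_of_ne {p : Λ} {a : Γ} {q : Λ} {b : Γ} {d : Dir} (h : d ≠ dir q) :
    (ofRule q₀ qa emb dir amp perm).δ p a q b d = 0 := by
  simp [h]

/-- Row-orthonormality of the pre-unitary: `∑_z conj (amp x z) · amp y z = [x = y]` — `amp` is a
unitary matrix on `ℓ²(Λ × Γ)` (Bernstein–Vazirani 1997, Thm. 5.3: unit length and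
orthogonality of the local columns). [cite: BernsteinVaziraniSICOMP1997, Thm. 5.3] -/
def IsRowOrthonormal (amp : Λ × Γ → Λ × Γ → ℂ) : Prop :=
  ∀ x y : Λ × Γ, ∑ z : Λ × Γ, conj (amp x z) * amp y z = if x = y then 1 else 0

/-- **Well-formedness of `ofRule` (tree model)**: a unitary pre-unitary gives a well-formed
machine (Bernstein–Vazirani 1997, Thm. 5.3 with the remark for unidirectional machines,
p. 1434; here via `QTM.isWellFormed_of_unidirectional`). [cite: BernsteinVaziraniSICOMP1997, Thm. 5.3 (remark, p. 1434)] -/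
theorem ofRule_isWellFormed (hamp : IsRowOrthonormal amp) :
    (ofRule q₀ qa emb dir amp perm).IsWellFormed := by
  classical
  have hD : ∀ p a q b d, d ≠ dir q → (ofRule q₀ qa emb dir amp perm).δ p a q b d = 0 :=
    fun p a q b d hd => ofRule_δ_of_ne q₀ qa emb dir amp perm hd
  -- the columns in the entering direction, reindexed along `perm`
  have hcol : ∀ (p₁ : Λ) (a₁ : Γ) (p₂ : Λ) (a₂ : Γ),
      ∑ y : Λ × Γ, conj ((ofRule q₀ qa emb dir amp perm).δ p₁ a₁ y.1 y.2 (dir y.1)) *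
          (ofRule q₀ qa emb dir amp perm).δ p₂ a₂ y.1 y.2 (dir y.1) =
        ∑ z : Λ × Γ, conj (amp (p₁, a₁) z) * amp (p₂, a₂) z := by
    intro p₁ a₁ p₂ a₂
    calc ∑ y : Λ × Γ, conj ((ofRule q₀ qa emb dir amp perm).δ p₁ a₁ y.1 y.2 (dir y.1)) *
          (ofRule q₀ qa emb dir amp perm).δ p₂ a₂ y.1 y.2 (dir y.1)
        = ∑ y : Λ × Γ, conj (amp (p₁, a₁) (perm.symm y)) * amp (p₂, a₂) (perm.symm y) :=
          Finset.sum_congr rfl fun y _ => by rw [ofRule_δ_dir, ofRule_δ_dir]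
      _ = ∑ z : Λ × Γ, conj (amp (p₁, a₁) z) * amp (p₂, a₂) z :=
          perm.symm.sum_comp (fun z => conj (amp (p₁, a₁) z) * amp (p₂, a₂) z)
  refine (ofRule q₀ qa emb dir amp perm).isWellFormed_of_unidirectional dir hD (fun p a => ?_)
    (fun p₁ a₁ p₂ a₂ hne => ?_)
  · have h := hcol p a p a
    rw [hamp (p, a) (p, a), if_pos rfl] at h
    have h' : (((∑ y : Λ × Γ, ‖(ofRule q₀ qa emb dir amp perm).δ p a y.1 y.2 (dir y.1)‖ ^ 2 : ℝ)) : ℂ) =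
        1 := by
      rw [← h, Complex.ofReal_sum]
      refine Finset.sum_congr rfl fun y _ => ?_
      rw [Complex.conj_mul', Complex.ofReal_pow]
    exact_mod_cast h'
  · rw [hcol, hamp (p₁, a₁) (p₂, a₂), if_neg hne]

/-- **Well-formedness of `ofRule` in Bernstein–Vazirani's positioned model**, for tape
alphabets with a non-blank symbol (`QTM.IsWellFormed.pIsWellFormed`). [cite: BernsteinVaziraniSICOMP1997, Def. 3.3 and Thm. 5.3] -/
theorem ofRule_pIsWellFormed (hamp : IsRowOrthonormal amp) (hΓ : ∃ a : Γ, a ≠ default) :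
    (ofRule q₀ qa emb dir amp perm).PIsWellFormed :=
  IsWellFormed.pIsWellFormed (M := ofRule q₀ qa emb dir amp perm) hΓ
    (ofRule_isWellFormed q₀ qa emb dir amp perm hamp)

/-- **Amplitude bookkeeping**: every transition amplitude of `ofRule` is `0` or a value of the
pre-unitary `amp` (for the classes `BQPQTMWith S`: it suffices that `0 ∈ S` and `amp` takes
values in `S`). [cite: BernsteinVaziraniSICOMP1997, §6 (amplitude sets)] -/
theorem ofRule_amplitudes_subset :
    (ofRule q₀ qa emb dir amp perm).amplitudes ⊆
      insert 0 (Set.range fun xz : (Λ × Γ) × (Λ × Γ) => amp xz.1 xz.2) := by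
  rintro z ⟨p, a, q, b, d, rfl⟩
  by_cases hd : d = dir q
  · subst hd
    exact Or.inr ⟨((p, a), perm.symm (q, b)), (ofRule_δ_dir q₀ qa emb dir amp perm p a q b).symm⟩
  · exact Or.inl (ofRule_δ_of_ne q₀ qa emb dir amp perm hd)

/-- Amplitude bookkeeping, set form: if `0 ∈ S` and all values of `amp` lie in `S` then the
amplitudes of `ofRule` lie in `S`. [cite: BernsteinVaziraniSICOMP1997, §6 (amplitude sets)] -/
theorem ofRule_amplitudes_subset_of {S : Set ℂ} (h0 : (0 : ℂ) ∈ S) (hS : ∀ x z, amp x z ∈ S) :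
    (ofRule q₀ qa emb dir amp perm).amplitudes ⊆ S := by
  refine (ofRule_amplitudes_subset q₀ qa emb dir amp perm).trans ?_
  rintro z (rfl | ⟨xz, rfl⟩)
  · exact h0
  · exact hS xz.1 xz.2

end Constructor


/-! ### Completing an injective partial rule to a bijection

Reversible deterministic machines are specified by PARTIAL transition functions that are
one-to-one where defined (Bernstein–Vazirani 1997, App. B: "`δ` is a one-to-one partial
function"; the completion to a total reversible machine is their Cor. B.2 / the remark that any
partial permutation matrix extends to a permutation matrix). The completion is
`QTM.completeRule`; only its values on the domain of the specification matter for the semantics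
of the constructed machines, the rest only for well-formedness. -/

section Complete

variable {α : Type*}

/-- A partial rule `f : α → Option α` is *injective* if distinct arguments in its domain have
distinct values (Bernstein–Vazirani 1997, App. B, Def. B.1: one-to-one partial transition
functions). [cite: BernsteinVaziraniSICOMP1997, App. B (Def. B.1)] -/
def PartialInjective (f : α → Option α) : Prop :=
  ∀ ⦃x y : α⦄ ⦃a : α⦄, f x = some a → f y = some a → x = y

/-- The domain of a partial rule, as a decidable predicate. [folklore] -/
abbrev pdom (f : α → Option α) (x : α) : Prop := (f x).isSome = true

/-- The partial rule restricted to its domain, as a function. [folklore] -/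
def pfun (f : α → Option α) (x : {x // pdom f x}) : α := (f x.1).get x.2

/-- An injective partial rule is an injective function on its domain. [folklore] -/
theorem pfun_injective {f : α → Option α} (hf : PartialInjective f) : Function.Injective (pfun f) := by
  rintro ⟨x, hx⟩ ⟨y, hy⟩ h
  have hx' : f x = some (pfun f ⟨x, hx⟩) := by simp [pfun]
  have hy' : f y = some (pfun f ⟨y, hy⟩) := by simp [pfun]
  rw [← h] at hy'
  exact Subtype.ext (hf hx' hy')

variable [Fintype α] [DecidableEq α]

open scoped Classical in
/-- **Completion of an injective partial rule to a bijection** (Bernstein–Vazirani 1997,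
App. B, Cor. B.2: a reversible partial transition table extends to a total one; here: an
injection from a subset of a finite set into the set extends to a permutation,
`Equiv.extendSubtype`). [cite: BernsteinVaziraniSICOMP1997, App. B (Cor. B.2)] -/
def completeRule (f : α → Option α) (hf : PartialInjective f) : α ≃ α :=
  (Equiv.ofInjective (pfun f) (pfun_injective hf)).extendSubtype

/-- The completion agrees with the partial rule on its domain. [cite: BernsteinVaziraniSICOMP1997, App. B (Cor. B.2)] -/
theorem completeRule_apply {f : α → Option α} (hf : PartialInjective f) {x a : α} (h : f x = some a) :
    completeRule f hf x = a := by
  classical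
  have hx : pdom f x := by simp [pdom, h]
  unfold completeRule
  rw [Equiv.extendSubtype_apply_of_mem _ _ hx, Equiv.ofInjective_apply]
  simp [pfun, h]

end Complete

/-! ### One positioned step of `ofRule` -/

section Step

variable {Λ Γ : Type} [Fintype Λ] [DecidableEq Λ] [Fintype Γ] [DecidableEq Γ] [Inhabited Γ]
variable (q₀ qa : Λ) (emb : Bool → Γ) (dir : Λ → Dir) (amp : Λ × Γ → Λ × Γ → ℂ)
  (perm : Λ × Γ ≃ Λ × Γ)

/-- The change of the absolute head position in direction `d` (`∓1`; Bernstein–Vazirani 1997,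
Def. 3.2). [cite: BernsteinVaziraniSICOMP1997, Def. 3.2] -/
def dirShift : Dir → ℤ
  | Dir.left => -1
  | Dir.right => 1

/-- Moving left decrements the position. [folklore] -/
@[simp] theorem dirShift_left : dirShift Dir.left = -1 := rfl
/-- Moving right increments the position. [folklore] -/
@[simp] theorem dirShift_right : dirShift Dir.right = 1 := rfl

/-- The positioned configuration reached from `c` when the local rule outputs the pair
`y = (q, b)`: write `b`, enter `q`, move in direction `dir q` (Bernstein–Vazirani 1997, Def. 3.2;
Nishimura–Ozawa 2002, §2). [cite: BernsteinVaziraniSICOMP1997, Def. 3.2] -/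
def detTarget (c : (ofRule q₀ qa emb dir amp perm).PCfg) (y : Λ × Γ) :
    (ofRule q₀ qa emb dir amp perm).PCfg :=
  ((⟨y.1, (c.1.tape.write y.2).move (dir y.1)⟩ : (ofRule q₀ qa emb dir amp perm).Cfg),
    c.2 + dirShift (dir y.1))

/-- The control state of the target is the output state. [folklore] -/
@[simp] theorem detTarget_q (c : (ofRule q₀ qa emb dir amp perm).PCfg) (y : Λ × Γ) :
    (detTarget q₀ qa emb dir amp perm c y).1.q = y.1 := rfl

/-- The head position of the target is `ξ + dirShift (dir q)`. [folklore] -/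
@[simp] theorem snd_detTarget (c : (ofRule q₀ qa emb dir amp perm).PCfg) (y : Λ × Γ) :
    (detTarget q₀ qa emb dir amp perm c y).2 = c.2 + dirShift (dir y.1) := rfl

/-- **The target in absolute cells**: the head cell is overwritten with the output symbol and no
other cell changes (Nishimura–Ozawa 2002, §2: `|q,T,ξ⟩ ↦ |p,T_ξ^τ,ξ+d⟩`). [cite: NishimuraOzawa2002, §2] -/
theorem cells_detTarget (c : (ofRule q₀ qa emb dir amp perm).PCfg) (y : Λ × Γ) :
    PCfg.cells (detTarget q₀ qa emb dir amp perm c y) = Function.update (PCfg.cells c) c.2 y.2 := by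
  unfold detTarget
  cases hd : dir y.1
  · simpa [hd, sub_eq_add_neg] using PCfg.cells_step_left c y.1 y.2
  · simpa [hd] using PCfg.cells_step_right c y.1 y.2

/-- `detTarget` is injective in the output pair, for a fixed source. [folklore] -/
theorem detTarget_injective (c : (ofRule q₀ qa emb dir amp perm).PCfg) :
    Function.Injective (detTarget q₀ qa emb dir amp perm c) := by
  intro y y' h
  have hq : y.1 = y'.1 := by simpa using congrArg (fun e => e.1.q) h
  have hc := congrArg PCfg.cells h
  rw [cells_detTarget, cells_detTarget] at hc
  have hb : y.2 = y'.2 := by simpa using congrFun hc c.2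
  exact Prod.ext hq hb

/-- **One positioned step of `ofRule` from a basis state**:
`U (a |c⟩) = ∑_z (a · amp (p, T₀) z) |tgt (perm z)⟩`, where `(p, T₀)` is the (state, scanned
symbol) pair of `c` (Bernstein–Vazirani 1997, Def. 3.2, for the kernel of `ofRule`). [cite: BernsteinVaziraniSICOMP1997, Def. 3.2] -/
theorem ofRule_pevolve_single (c : (ofRule q₀ qa emb dir amp perm).PCfg) (a : ℂ) :
    (ofRule q₀ qa emb dir amp perm).pevolve (Finsupp.single c a) =
      ∑ z : Λ × Γ, (a * amp (c.1.q, c.1.tape.head) z) •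
        Finsupp.single (detTarget q₀ qa emb dir amp perm c (perm z)) (1 : ℂ) := by
  classical
  unfold pevolve pevolveWith
  rw [Finsupp.sum_single_index ((ofRule q₀ qa emb dir amp perm).pstep_zero _ c)]
  -- write `pstep` as a sum over output pairs `(q, b)`
  have hstep : (ofRule q₀ qa emb dir amp perm).pstep (ofRule q₀ qa emb dir amp perm).δ c a =
      ∑ y : Λ × Γ, (a * amp (c.1.q, c.1.tape.head) (perm.symm y)) •
        Finsupp.single (detTarget q₀ qa emb dir amp perm c y) (1 : ℂ) := by
    unfold pstep
    rw [Fintype.sum_prod_type (f := fun y : Λ × Γ =>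
      (a * amp (c.1.q, c.1.tape.head) (perm.symm y)) •
        Finsupp.single (detTarget q₀ qa emb dir amp perm c y) (1 : ℂ))]
    refine Finset.sum_congr rfl fun q' _ => Finset.sum_congr rfl fun b _ => ?_
    cases hd : dir q'
    · have hR : (ofRule q₀ qa emb dir amp perm).δ c.1.q c.1.tape.head q' b Dir.right = 0 :=
        ofRule_δ_of_ne q₀ qa emb dir amp perm (by rw [hd]; decide)
      have hL : (ofRule q₀ qa emb dir amp perm).δ c.1.q c.1.tape.head q' b Dir.left =
          amp (c.1.q, c.1.tape.head) (perm.symm (q', b)) := by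
        rw [← hd]; exact ofRule_δ_dir q₀ qa emb dir amp perm _ _ _ _
      rw [hR, hL, mul_zero, zero_smul, add_zero]
      simp [detTarget, hd, sub_eq_add_neg]
    · have hL : (ofRule q₀ qa emb dir amp perm).δ c.1.q c.1.tape.head q' b Dir.left = 0 :=
        ofRule_δ_of_ne q₀ qa emb dir amp perm (by rw [hd]; decide)
      have hR : (ofRule q₀ qa emb dir amp perm).δ c.1.q c.1.tape.head q' b Dir.right =
          amp (c.1.q, c.1.tape.head) (perm.symm (q', b)) := by
        rw [← hd]; exact ofRule_δ_dir q₀ qa emb dir amp perm _ _ _ _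
      rw [hR, hL, mul_zero, zero_smul, zero_add]
      simp [detTarget, hd]
  rw [hstep]
  exact (perm.sum_comp (fun y => (a * amp (c.1.q, c.1.tape.head) (perm.symm y)) •
    Finsupp.single (detTarget q₀ qa emb dir amp perm c y) (1 : ℂ))).symm.trans
      (Finset.sum_congr rfl fun z _ => by rw [Equiv.symm_apply_apply])

/-- **The classical case**: if the column of the scanned pair `x = (p, T₀)` under the pre-unitary
is the basis vector of `x` itself (`amp x z = [z = x]`), the step is deterministic:
`U (a |c⟩) = a |tgt (perm x)⟩` — the reversible-TM step of Bernstein–Vazirani 1997, App. B. [cite: BernsteinVaziraniSICOMP1997, App. B (Cor. B.2)] -/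
theorem ofRule_pevolve_single_of_classical (c : (ofRule q₀ qa emb dir amp perm).PCfg) (a : ℂ)
    (hx : ∀ z, amp (c.1.q, c.1.tape.head) z = if z = (c.1.q, c.1.tape.head) then 1 else 0) :
    (ofRule q₀ qa emb dir amp perm).pevolve (Finsupp.single c a) =
      Finsupp.single (detTarget q₀ qa emb dir amp perm c (perm (c.1.q, c.1.tape.head))) a := by
  classical
  rw [ofRule_pevolve_single]
  simp_rw [hx]
  rw [Finset.sum_eq_single (c.1.q, c.1.tape.head)]
  · simp
  · intro z _ hz; simp [hz]
  · intro h; exact absurd (Finset.mem_univ _) h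

end Step

end QTM

end Literature.Computability.Cryptography
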